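import Literature.MathematicalPhysics.KineticTheory.Hilbert6Wave0

/-!
# From a.e. unit Radon–Nikodym derivative to collision invariance (helper for `ParityRigidity`)

Three pieces of measure-theoretic bookkeeping for the rigidity theorem `ParityRigidity`:

* `map_eq_self_of_rnDeriv_eq_one`: an abstract lemma — a measurable involution `T` of a finite
  measure space with `μ (T⁻¹ H) = μ H`, fixing the complement of `H ∪ T⁻¹ H` pointwise, and with
  `d(T_# μ)/dμ = 1` a.e. on `H`, preserves `μ`;
* `map_collide_prod_eq_of_ae_rnDeriv`: its instance for the elastic collision map `collide ω`
  acting on `m ⊗ m` transported to the Euclidean product `WithLp 2 (E × E)` (the half-spaces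
  `{⟪v_* - v, ω⟫ ≷ 0}` are swapped by the collision and exchanged by the symmetry of `m ⊗ m`);
* `charFun_mul_eq_of_map_collide` / `charFun_mul_eq_of_ae`: invariance of `m ⊗ m` under
  `collide ω` gives the multiplicative collision invariance of the characteristic function
  `φ ξ φ η = φ ξ' φ η'`, and an a.e.-in-`ω` identity upgrades to all `ω` by continuity
  (the surface measure charges open sets).

Helper file for item stmt-AtomisticToContinuum-13084 (route JParityClosure, decl `ParityRigidity`).
-/

open MeasureTheory Metric Real Filter Topology Set Complex
open scoped InnerProductSpace ENNReal NNReal Topology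

namespace Summit.AtomisticToContinuum.HydrodynamicLimit.Theorems.ParityRigidity

open Literature.MathematicalPhysics.KineticTheory

/-! ### An abstract invariance lemma -/

/-- A measurable involution `T` of a finite measure space with `μ (T⁻¹ H) = μ H`, fixing every
point outside `H ∪ T⁻¹ H`, and such that the Radon–Nikodym derivative of `T_# μ` with respect to
`μ` equals `1` a.e. on `H`, preserves `μ`. -/
theorem map_eq_self_of_rnDeriv_eq_one {X : Type*} [MeasurableSpace X] (μ : Measure X)
    [IsFiniteMeasure μ] {T : X → X} (hT : Measurable T) (hTT : ∀ x, T (T x) = x) {H : Set X}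
    (hH : MeasurableSet H) (hμH : μ (T ⁻¹' H) = μ H)
    (hfix : ∀ x, x ∉ H → T x ∉ H → T x = x)
    (hR : ∀ᵐ x ∂μ, x ∈ H → (μ.map T).rnDeriv μ x = 1) : μ.map T = μ := by
  set ρ := μ.map T with hρ
  haveI : IsFiniteMeasure ρ := Measure.isFiniteMeasure_map μ T
  have hρapp : ∀ s, MeasurableSet s → ρ s = μ (T ⁻¹' s) := fun s hs => Measure.map_apply hT hs
  -- Step 1: `μ A ≤ ρ A` for measurable `A ⊆ H`.
  have hle : ∀ A, MeasurableSet A → A ⊆ H → μ A ≤ ρ A := by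
    intro A hA hAH
    calc μ A = ∫⁻ _ in A, 1 ∂μ := by rw [setLIntegral_const, one_mul]
      _ = ∫⁻ x in A, ρ.rnDeriv μ x ∂μ := by
          refine lintegral_congr_ae ?_
          filter_upwards [ae_restrict_mem hA, ae_restrict_of_ae hR] with x hx hRx
          exact (hRx (hAH hx)).symm
      _ = μ.withDensity (ρ.rnDeriv μ) A := (withDensity_apply _ hA).symm
      _ ≤ ρ A := Measure.withDensity_rnDeriv_le ρ μ A
  -- Step 2: equality on measurable subsets of `H` (equal total mass on `H`).
  have hρH : ρ H = μ H := by rw [hρapp H hH, hμH]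
  have heqH : ∀ A, MeasurableSet A → A ⊆ H → ρ A = μ A := by
    intro A hA hAH
    have h1 := hle A hA hAH
    have h2 := hle (H \ A) (hH.diff hA) Set.sdiff_subset
    have hsumρ : ρ A + ρ (H \ A) = ρ H := by
      rw [← measure_union disjoint_sdiff_right (hH.diff hA), Set.union_sdiff_cancel hAH]
    have hsumμ : μ A + μ (H \ A) = μ H := by
      rw [← measure_union disjoint_sdiff_right (hH.diff hA), Set.union_sdiff_cancel hAH]
    refine le_antisymm ?_ h1
    by_contra hcon
    have hlt : μ A < ρ A := not_le.1 hcon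
    have : μ A + μ (H \ A) < ρ A + ρ (H \ A) :=
      calc μ A + μ (H \ A) ≤ μ A + ρ (H \ A) := add_le_add le_rfl h2
        _ < ρ A + ρ (H \ A) := ENNReal.add_lt_add_right (measure_ne_top ρ _) hlt
    rw [hsumρ, hsumμ, hρH] at this
    exact lt_irrefl _ this
  -- Step 3: assemble on an arbitrary measurable set.
  refine Measure.ext fun A hA => ?_
  have hH' : MeasurableSet (T ⁻¹' H) := hT hH
  rw [← measure_inter_add_sdiff A hH, ← measure_inter_add_sdiff A hH,
    ← measure_inter_add_sdiff (A \ H) hH', ← measure_inter_add_sdiff (A \ H) hH']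
  have e1 : ρ (A ∩ H) = μ (A ∩ H) := heqH _ (hA.inter hH) inter_subset_right
  have e2 : ρ (A \ H ∩ T ⁻¹' H) = μ (A \ H ∩ T ⁻¹' H) := by
    set B := A \ H ∩ T ⁻¹' H with hB
    have hBm : MeasurableSet B := (hA.diff hH).inter hH'
    have hTB : T ⁻¹' B ⊆ H := fun x hx => by
      have := hx.2
      simp only [mem_preimage, hTT] at this
      exact this
    have hTBm : MeasurableSet (T ⁻¹' B) := hT hBm
    rw [hρapp B hBm, ← heqH _ hTBm hTB, hρapp _ hTBm]
    congr 1
    ext x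
    simp only [mem_preimage, hTT]
  have e3 : ρ ((A \ H) \ T ⁻¹' H) = μ ((A \ H) \ T ⁻¹' H) := by
    have hCm : MeasurableSet ((A \ H) \ T ⁻¹' H) := (hA.diff hH).diff hH'
    rw [hρapp _ hCm]
    congr 1
    ext x
    simp only [mem_preimage, Set.mem_sdiff]
    constructor
    · rintro ⟨⟨hxA, hxH⟩, hxH'⟩
      rw [hTT] at hxH'
      have hx : T x = x := by
        have := hfix (T x) hxH (by rwa [hTT])
        rw [hTT] at this
        exact this.symm
      rw [hx] at hxA hxH
      exact ⟨⟨hxA, hxH⟩, by rw [hx]; exact hxH⟩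
    · rintro ⟨⟨hxA, hxH⟩, hxH'⟩
      have hx : T x = x := hfix x hxH hxH'
      refine ⟨⟨by rwa [hx], by rwa [hx]⟩, by rwa [hTT]⟩
  rw [e1, e2, e3]


/-! ### Elementary facts about the collision map -/

section Collide

variable {E : Type*} [NormedAddCommGroup E] [InnerProductSpace ℝ E]

/-- The collision map is continuous in the velocity pair. -/
theorem continuous_collide (ω : sphere (0 : E) 1) : Continuous (collide ω : E × E → E × E) := by
  unfold collide
  fun_prop

/-- The collision map is continuous in the impact direction. -/
theorem continuous_collide_dir (p : E × E) : Continuous fun ω : sphere (0 : E) 1 => collide ω p := by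
  unfold collide
  fun_prop

/-- The collision reverses the normal relative velocity:
`⟪v_*' - v', ω⟫ = -⟪v_* - v, ω⟫`. -/
theorem inner_collide_snd_sub_fst (ω : sphere (0 : E) 1) (p : E × E) :
    ⟪(collide ω p).2 - (collide ω p).1, (ω : E)⟫_ℝ = -⟪p.2 - p.1, (ω : E)⟫_ℝ := by
  have h := real_inner_self_sphere ω
  simp only [collide, inner_sub_left, inner_add_left, real_inner_smul_left, h]
  ring

/-- A pair with vanishing normal relative velocity is fixed by the collision. -/
theorem collide_eq_self_of_inner_eq_zero (ω : sphere (0 : E) 1) (p : E × E)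
    (h0 : ⟪p.2 - p.1, (ω : E)⟫_ℝ = 0) : collide ω p = p := by
  have h1 : ⟪p.1 - p.2, (ω : E)⟫_ℝ = 0 := by
    rw [← neg_sub, inner_neg_left, h0, neg_zero]
  obtain ⟨a, b⟩ := p
  simp only [collide, h1, zero_smul, sub_zero, add_zero]

/-- The symmetric bilinear identity behind the self-adjointness of the collision map:
`⟪v, ξ'⟫ + ⟪v_*, η'⟫ = ⟪v', ξ⟫ + ⟪v_*', η⟫`. -/
theorem inner_collide_symm (ω : sphere (0 : E) 1) (p : E × E) (ξ η : E) :
    ⟪p.1, (collide ω (ξ, η)).1⟫_ℝ + ⟪p.2, (collide ω (ξ, η)).2⟫_ℝ =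
      ⟪(collide ω p).1, ξ⟫_ℝ + ⟪(collide ω p).2, η⟫_ℝ := by
  simp only [collide, inner_sub_left, inner_sub_right, inner_add_left, inner_add_right,
    real_inner_smul_left, real_inner_smul_right]
  rw [real_inner_comm ξ (ω : E), real_inner_comm η (ω : E)]
  ring

end Collide

/-! ### Collision invariance of `m ⊗ m` and the characteristic function -/

section CharFun

variable {E : Type*} [NormedAddCommGroup E] [InnerProductSpace ℝ E] [MeasurableSpace E]
  [BorelSpace E] [SecondCountableTopology E]

/-- If `m ⊗ m` is invariant under the collision with impact direction `ω`, the characteristic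
function of `m` is multiplicatively collision invariant for `ω`:
`φ ξ φ η = φ ξ' φ η'`. -/
theorem charFun_mul_eq_of_map_collide (m : Measure E) [IsFiniteMeasure m] (ω : sphere (0 : E) 1)
    (h : (m.prod m).map (collide ω) = m.prod m) (ξ η : E) :
    charFun m ξ * charFun m η =
      charFun m (collide ω (ξ, η)).1 * charFun m (collide ω (ξ, η)).2 := by
  have key : ∀ ξ η : E, charFun m ξ * charFun m η =
      ∫ p, cexp ((⟪p.1, ξ⟫_ℝ : ℂ) * I) * cexp ((⟪p.2, η⟫_ℝ : ℂ) * I) ∂(m.prod m) := by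
    intro ξ η
    rw [charFun_apply, charFun_apply, ← integral_prod_mul]
  rw [key, key]
  have hmeas : AEMeasurable (collide ω) (m.prod m) := (continuous_collide ω).measurable.aemeasurable
  have hint : AEStronglyMeasurable
      (fun p : E × E => cexp ((⟪p.1, ξ⟫_ℝ : ℂ) * I) * cexp ((⟪p.2, η⟫_ℝ : ℂ) * I))
      ((m.prod m).map (collide ω)) :=
    (Continuous.aestronglyMeasurable (by fun_prop))
  calc ∫ p, cexp ((⟪p.1, ξ⟫_ℝ : ℂ) * I) * cexp ((⟪p.2, η⟫_ℝ : ℂ) * I) ∂(m.prod m)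
      = ∫ p, cexp ((⟪p.1, ξ⟫_ℝ : ℂ) * I) * cexp ((⟪p.2, η⟫_ℝ : ℂ) * I)
          ∂((m.prod m).map (collide ω)) := by rw [h]
    _ = ∫ p, cexp ((⟪(collide ω p).1, ξ⟫_ℝ : ℂ) * I) * cexp ((⟪(collide ω p).2, η⟫_ℝ : ℂ) * I)
          ∂(m.prod m) := integral_map hmeas hint
    _ = ∫ p, cexp ((⟪p.1, (collide ω (ξ, η)).1⟫_ℝ : ℂ) * I) *
          cexp ((⟪p.2, (collide ω (ξ, η)).2⟫_ℝ : ℂ) * I) ∂(m.prod m) := by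
        refine integral_congr_ae (Eventually.of_forall fun p => ?_)
        simp only [← Complex.exp_add, ← add_mul, ← Complex.ofReal_add]
        rw [inner_collide_symm ω p ξ η]

variable [FiniteDimensional ℝ E]

/-- An a.e.-in-`ω` multiplicative collision invariance of the characteristic function holds for
every impact direction (both sides are continuous in `ω` and the surface measure charges every
nonempty open subset of the sphere). -/
theorem charFun_mul_eq_of_ae (m : Measure E) [IsFiniteMeasure m]
    (h : ∀ᵐ ω ∂(sphereMeasure : Measure (sphere (0 : E) 1)), ∀ ξ η : E,
      charFun m ξ * charFun m η =
        charFun m (collide ω (ξ, η)).1 * charFun m (collide ω (ξ, η)).2)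
    (ω : sphere (0 : E) 1) (ξ η : E) :
    charFun m ξ * charFun m η =
      charFun m (collide ω (ξ, η)).1 * charFun m (collide ω (ξ, η)).2 := by
  haveI : (sphereMeasure : Measure (sphere (0 : E) 1)).IsOpenPosMeasure := by
    unfold sphereMeasure; infer_instance
  have hcont : Continuous fun ω : sphere (0 : E) 1 =>
      charFun m (collide ω (ξ, η)).1 * charFun m (collide ω (ξ, η)).2 :=
    (continuous_charFun.comp (continuous_fst.comp (continuous_collide_dir (ξ, η)))).mul
      (continuous_charFun.comp (continuous_snd.comp (continuous_collide_dir (ξ, η))))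
  have hae : (fun ω : sphere (0 : E) 1 =>
      charFun m (collide ω (ξ, η)).1 * charFun m (collide ω (ξ, η)).2) =ᵐ[sphereMeasure]
        fun _ => charFun m ξ * charFun m η := by
    filter_upwards [h] with ω hω
    exact (hω ξ η).symm
  have := Measure.eq_of_ae_eq hae hcont continuous_const
  exact (congrFun this ω).symm

omit [FiniteDimensional ℝ E] in
/-- **Collision invariance of `m ⊗ m` from the Radon–Nikodym derivative.** Transport `m ⊗ m` to
the Euclidean product `WithLp 2 (E × E)` and let `T̂` be the transported collision map with
impact direction `ω`.  If `d(T̂_# μ̂)/dμ̂ = 1` a.e. on the half-space `{⟪v_* - v, ω⟫ > 0}`, then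
`m ⊗ m` is invariant under `collide ω`. -/
theorem map_collide_prod_eq_of_ae_rnDeriv (m : Measure E) [IsFiniteMeasure m]
    (ω : sphere (0 : E) 1)
    (h : ∀ᵐ x ∂(((m.prod m).map (WithLp.toLp 2)) : Measure (WithLp 2 (E × E))),
      0 < ⟪(WithLp.ofLp x).2 - (WithLp.ofLp x).1, (ω : E)⟫_ℝ →
        ((((m.prod m).map (WithLp.toLp 2)).map
          (fun x : WithLp 2 (E × E) => WithLp.toLp 2 (collide ω (WithLp.ofLp x)))).rnDeriv
          ((m.prod m).map (WithLp.toLp 2))) x = 1) :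
    (m.prod m).map (collide ω) = m.prod m := by
  set μ : Measure (E × E) := m.prod m with hμ
  set ν : Measure (WithLp 2 (E × E)) := μ.map (WithLp.toLp 2) with hν
  set T : WithLp 2 (E × E) → WithLp 2 (E × E) :=
    fun x => WithLp.toLp 2 (collide ω (WithLp.ofLp x)) with hT
  haveI : IsFiniteMeasure ν := Measure.isFiniteMeasure_map μ _
  have htoLp : Measurable (WithLp.toLp 2 : E × E → WithLp 2 (E × E)) := WithLp.measurable_toLp 2 _
  have hofLp : Measurable (WithLp.ofLp : WithLp 2 (E × E) → E × E) := WithLp.measurable_ofLp 2 _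
  have hTm : Measurable T := htoLp.comp ((continuous_collide ω).measurable.comp hofLp)
  have hTT : ∀ x, T (T x) = x := fun x => by
    simp only [hT, collide_collide, WithLp.toLp_ofLp]
  set H : Set (WithLp 2 (E × E)) := {x | 0 < ⟪(WithLp.ofLp x).2 - (WithLp.ofLp x).1, (ω : E)⟫_ℝ}
    with hH
  have hg : Measurable fun x : WithLp 2 (E × E) => ⟪(WithLp.ofLp x).2 - (WithLp.ofLp x).1, (ω : E)⟫_ℝ :=
    (Continuous.measurable (by fun_prop) : Measurable fun p : E × E => ⟪p.2 - p.1, (ω : E)⟫_ℝ).comp hofLp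
  have hHm : MeasurableSet H := measurableSet_lt measurable_const hg
  -- the preimage of `H` is the opposite half-space
  have hTH : T ⁻¹' H = {x | ⟪(WithLp.ofLp x).2 - (WithLp.ofLp x).1, (ω : E)⟫_ℝ < 0} := by
    ext x
    simp only [hT, hH, mem_preimage, mem_setOf_eq, inner_collide_snd_sub_fst, neg_pos]
  have hS'm : MeasurableSet {p : E × E | ⟪p.2 - p.1, (ω : E)⟫_ℝ < 0} :=
    measurableSet_lt (Continuous.measurable (by fun_prop)) measurable_const
  have hμH : ν (T ⁻¹' H) = ν H := by
    have hTHm : MeasurableSet (T ⁻¹' H) := hTm hHm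
    rw [hν, Measure.map_apply htoLp hTHm, Measure.map_apply htoLp hHm, hTH]
    have e1 : (WithLp.toLp 2 ⁻¹' {x : WithLp 2 (E × E) |
        ⟪(WithLp.ofLp x).2 - (WithLp.ofLp x).1, (ω : E)⟫_ℝ < 0}) =
        {p : E × E | ⟪p.2 - p.1, (ω : E)⟫_ℝ < 0} := by
      ext p; simp
    have e2 : (WithLp.toLp 2 ⁻¹' H) = {p : E × E | 0 < ⟪p.2 - p.1, (ω : E)⟫_ℝ} := by
      ext p; simp [hH]
    have hswap : Prod.swap ⁻¹' {p : E × E | ⟪p.2 - p.1, (ω : E)⟫_ℝ < 0} =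
        {p : E × E | 0 < ⟪p.2 - p.1, (ω : E)⟫_ℝ} := by
      ext p
      simp only [mem_preimage, mem_setOf_eq, Prod.fst_swap, Prod.snd_swap]
      rw [← neg_sub, inner_neg_left, neg_lt_zero]
    rw [e1, e2, ← hswap, ← Measure.map_apply measurable_swap hS'm, hμ, Measure.prod_swap]
  have hfix : ∀ x, x ∉ H → T x ∉ H → T x = x := by
    intro x hx hTx
    have hx' : ¬ (0 < ⟪(WithLp.ofLp x).2 - (WithLp.ofLp x).1, (ω : E)⟫_ℝ) := hx
    have hTx' : x ∈ T ⁻¹' H → False := hTx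
    rw [hTH] at hTx'
    have hTx'' : ¬ (⟪(WithLp.ofLp x).2 - (WithLp.ofLp x).1, (ω : E)⟫_ℝ < 0) := hTx'
    have h0 : ⟪(WithLp.ofLp x).2 - (WithLp.ofLp x).1, (ω : E)⟫_ℝ = 0 :=
      le_antisymm (not_lt.1 hx') (not_lt.1 hTx'')
    simp only [hT, collide_eq_self_of_inner_eq_zero ω _ h0, WithLp.toLp_ofLp]
  have hinv : ν.map T = ν := map_eq_self_of_rnDeriv_eq_one ν hTm hTT hHm hμH hfix h
  -- pull back along `ofLp`
  have hfun : ((WithLp.ofLp ∘ T) ∘ WithLp.toLp 2 : E × E → E × E) = collide ω := by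
    funext p
    simp [hT]
  have hid : (WithLp.ofLp ∘ WithLp.toLp 2 : E × E → E × E) = id := funext fun _ => rfl
  calc μ.map (collide ω) = (ν.map T).map WithLp.ofLp := by
        rw [hν, Measure.map_map hofLp hTm, Measure.map_map (hofLp.comp hTm) htoLp, hfun]
    _ = ν.map WithLp.ofLp := by rw [hinv]
    _ = μ := by rw [hν, Measure.map_map hofLp htoLp, hid, Measure.map_id]

end CharFun

end Summit.AtomisticToContinuum.HydrodynamicLimit.Theorems.ParityRigidity
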